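import Mathlib.FieldTheory.Finite.GaloisField
import Literature.NumberTheory.EllipticCurves.FrobeniusEndomorphism
import Literature.AlgebraicGeometry.Motives.FaltingsECTateLemma1Proofs
import HarnessLib

/-!
# Maps of Tate modules commuting with Frobenius are Galois-equivariant

Topic: elliptic curves over finite fields (trunk T-ELLARITH); complements
`Literature.NumberTheory.EllipticCurves.FrobeniusEndomorphism` (the `q`-power Frobenius
endomorphism `WeierstrassCurve.frobeniusIsogeny hσ` attached to an element `σ_q ∈ Γ_k` acting on
`k̄` by `x ↦ x ^ q`, and `T_ℓ(π_E) = ρ(σ_q)`), and serves the finite-field part of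
`Literature.AlgebraicGeometry.Motives.FaltingsEC` (Tate's theorem
`Literature.AlgebraicGeometry.Motives.mem_span_range_tateModule_map_of_equivariant_of_finite`), where `Γ_k`-equivariance has
to be produced from commutation with the single endomorphism `T_ℓ(π_E)` (Tate, Invent. Math. 2
(1966), p. 138: "The effect of `π` on `A(k̄)`, and therefore on `V_ℓ(A)`, is the same as that of the
Frobenius automorphism of `k̄/k`, which is a topological generator of `G`").

All statements quantify over an element `σ ∈ Γ_k` with `σ x = x ^ q` on `k̄` (hypothesis `hσ`;
there is exactly one, `WeierstrassCurve.exists_frobenius_absoluteGaloisGroup`,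
`frobenius_absoluteGaloisGroup_unique` of `FrobeniusTateModule`), as in `FrobeniusEndomorphism`.

* `WeierstrassCurve.exists_smul_eq_frobenius_pow_smul`: every `τ ∈ Γ_k` acts on any *finite*
  subset of `k̄` as a power of `σ_q` (the finite extension generated by the subset is normal with
  cyclic Galois group generated by Frobenius; Mathlib
  `FiniteField.bijective_frobeniusAlgEquivOfAlgebraic_pow`), with versions for finitely many
  geometric points of one or two curves (`…_of_finite`, `…_of_finite₂`).
* `WeierstrassCurve.smul_comm_of_frobenius`: **a `ℤ_ℓ`-linear map `f : T_ℓ E → T_ℓ E'` with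
  `f (σ_q x) = σ_q (f x)` commutes with all of `Γ_k`**, for arbitrary Weierstrass curves `E, E'`
  over `k` and any prime `ℓ`. Proof: fix `τ`, `x` and a level `n`; the `n`-th component of `f y`
  depends only on `y_n` (`Literature.NumberTheory.EllipticCurves.TateModule.proj_apply_eq_of_proj_eq`:
  `ker (T_ℓ A → A[ℓ^n]) = ℓ^n T_ℓ A`); choose `j` with `τ = σ_q ^ j` on the two points `x_n`,
  `(f x)_n`; then `(f (τ x))_n = (f (σ^j x))_n = (σ^j f x)_n = (τ f x)_n`.
* `WeierstrassCurve.forall_smul_comm_iff_comp_tateModule_map_frobeniusIsogeny`: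
  `Hom_{Γ_k}(T_ℓ E, T_ℓ E') = {f | f ∘ T_ℓ(π_E) = T_ℓ(π_{E'}) ∘ f}`, and
  `WeierstrassCurve.tateModule_map_comp_tateModule_map_frobeniusIsogeny`: the Tate-module map of
  an isogeny over `k` intertwines the Frobenius endomorphisms.

## References

* [Tate1966Endomorphisms] J. Tate, *Endomorphisms of abelian varieties over finite fields*,
  Invent. Math. 2 (1966), 134–144, §2, p. 138.
* [SilvermanAEC2009] J. H. Silverman, *The Arithmetic of Elliptic Curves*, 2nd ed., GTM 106,
  II.2.10–2.12, Example III.4.6, III.§7, V.§2.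
* [SerreLocalFields1979] J.-P. Serre, *Local Fields*, GTM 67, XIII §1 (`Gal(k̄/k) ≅ Ẑ`,
  topologically generated by Frobenius).
-/

noncomputable section

open scoped Classical

universe u

namespace WeierstrassCurve

open Literature.NumberTheory.EllipticCurves

variable {K : Type u} [Field K]

/-! ## `Γ_k` acts on finite subsets of `k̄` through powers of Frobenius -/

section Frobenius

variable [Finite K] {σ : Field.absoluteGaloisGroup K}

omit [Finite K] in
/-- Powers of the Frobenius element: `σ_q ^ n • x = x ^ (q ^ n)`. [folklore] -/
theorem frobenius_pow_smul (hσ : ∀ x : AlgebraicClosure K, σ • x = x ^ Nat.card K) (n : ℕ)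
    (x : AlgebraicClosure K) : σ ^ n • x = x ^ Nat.card K ^ n := by
  induction n with
  | zero => simp
  | succ n ih => rw [pow_succ, mul_smul, hσ, smul_pow', ih, ← pow_mul, ← pow_succ]

/-- **`Γ_k` acts on finite subsets of `k̄` through powers of Frobenius.** For a finite field `k`,
`σ_q ∈ Γ_k` the Frobenius (`σ_q x = x ^ q`), any `τ ∈ Gal(k̄/k)` and a finite set `s ⊆ k̄`, there
is `n` with `τ x = σ_q ^ n x` for all `x ∈ s`: the field `k(s)` is a finite extension of `k`,
normal, and its automorphisms over `k` are the powers of the Frobenius (Mathlib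
`FiniteField.bijective_frobeniusAlgEquivOfAlgebraic_pow`). Serre, *Local Fields*, XIII §1
(`Gal(k̄/k) = Ẑ`, topologically generated by Frobenius); Tate, Invent. Math. 2 (1966), p. 138.
[folklore] -/
theorem exists_smul_eq_frobenius_pow_smul (hσ : ∀ x : AlgebraicClosure K, σ • x = x ^ Nat.card K)
    (τ : Field.absoluteGaloisGroup K) {s : Set (AlgebraicClosure K)} (hs : s.Finite) :
    ∃ n : ℕ, ∀ x ∈ s, τ • x = σ ^ n • x := by
  letI := Fintype.ofFinite K
  haveI : Finite s := hs.to_subtype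
  set L : IntermediateField K (AlgebraicClosure K) := IntermediateField.adjoin K s with hL
  haveI : FiniteDimensional K L :=
    IntermediateField.finiteDimensional_adjoin fun x _ ↦ Algebra.IsIntegral.isIntegral x
  haveI : Finite L := Module.finite_of_finite K
  -- `τ` restricted to the normal extension `L / K` is a power of the Frobenius of `L / K`
  obtain ⟨m, hm⟩ := (FiniteField.bijective_frobeniusAlgEquivOfAlgebraic_pow K L).2
    (AlgEquiv.restrictNormal (show AlgebraicClosure K ≃ₐ[K] AlgebraicClosure K from τ) L)
  refine ⟨m.1, fun x hx ↦ ?_⟩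
  have hxL : x ∈ L := IntermediateField.subset_adjoin K s hx
  have h1 := congrArg (fun ρ : L ≃ₐ[K] L ↦ ((ρ ⟨x, hxL⟩ : L) : AlgebraicClosure K)) hm
  simp only at h1
  rw [AlgEquiv.restrictNormal_apply, AlgEquiv.coe_pow,
    FiniteField.coe_frobeniusAlgEquivOfAlgebraic_iterate] at h1
  rw [frobenius_pow_smul hσ, Nat.card_eq_fintype_card]
  change (show AlgebraicClosure K ≃ₐ[K] AlgebraicClosure K from τ) x = _
  rw [← h1]
  rfl

end Frobenius

/-! ## Finitely many geometric points -/

section Points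

variable (W : WeierstrassCurve K)

/-- Two elements of `Γ_K` agreeing on the coordinates of a geometric point agree on the point: for
every `P ∈ E(K̄)` there is a finite set `s ⊆ K̄` (its affine coordinates) such that `τ • P = τ' • P`
whenever `τ, τ' ∈ Γ_K` agree on `s`. Silverman, *AEC*, VIII.§1. [folklore] -/
theorem exists_finite_smul_eq_of_eqOn (P : W.geomPoints) :
    ∃ s : Set (AlgebraicClosure K), s.Finite ∧ ∀ τ τ' : Field.absoluteGaloisGroup K,
      (∀ x ∈ s, τ • x = τ' • x) → τ • P = τ' • P := by
  cases P with
  | zero => exact ⟨∅, Set.finite_empty, fun τ τ' _ ↦ by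
      change τ • (0 : W.geomPoints) = τ' • (0 : W.geomPoints)
      rw [smul_zero, smul_zero]⟩
  | some x y h =>
    refine ⟨{x, y}, Set.toFinite _, fun τ τ' hττ' ↦ ?_⟩
    have hx : τ • x = τ' • x := hττ' x (by simp)
    have hy : τ • y = τ' • y := hττ' y (by simp)
    exact ((Affine.Point.map_some (f := ((show AlgebraicClosure K ≃ₐ[K] AlgebraicClosure K
        from τ) : AlgebraicClosure K →ₐ[K] AlgebraicClosure K)) h).trans
      (by congr 1)).trans (Affine.Point.map_some (f := ((show
        AlgebraicClosure K ≃ₐ[K] AlgebraicClosure K from τ') :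
          AlgebraicClosure K →ₐ[K] AlgebraicClosure K)) h).symm

variable [Finite K] {σ : Field.absoluteGaloisGroup K}

/-- **`Γ_k` acts on finitely many geometric points through a power of Frobenius**: for `τ ∈ Γ_k`
and a finite set `S` of `k̄`-points of `E` there is `n` with `τ • P = σ_q ^ n • P` for all `P ∈ S`
(apply `exists_smul_eq_frobenius_pow_smul` to the coordinates). Serre, *Local Fields*, XIII §1;
Tate, Invent. Math. 2 (1966), p. 138. [folklore] -/
theorem exists_smul_eq_frobenius_pow_smul_of_finite
    (hσ : ∀ x : AlgebraicClosure K, σ • x = x ^ Nat.card K) (τ : Field.absoluteGaloisGroup K)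
    {S : Set W.geomPoints} (hS : S.Finite) :
    ∃ n : ℕ, ∀ P ∈ S, τ • P = σ ^ n • P := by
  choose s hs hsP using fun P : W.geomPoints ↦ W.exists_finite_smul_eq_of_eqOn P
  obtain ⟨n, hn⟩ := exists_smul_eq_frobenius_pow_smul hσ τ
    ((hS.biUnion fun P _ ↦ hs P) : (⋃ P ∈ S, s P).Finite)
  exact ⟨n, fun P hP ↦ hsP P τ _ fun x hx ↦ hn x (Set.mem_biUnion hP hx)⟩

/-- Two curves at once: for `τ ∈ Γ_k` and finite sets `S ⊆ E(k̄)`, `S' ⊆ E'(k̄)` there is one `n`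
with `τ = σ_q ^ n` on both. [folklore] -/
theorem exists_smul_eq_frobenius_pow_smul_of_finite₂ {W' : WeierstrassCurve K}
    (hσ : ∀ x : AlgebraicClosure K, σ • x = x ^ Nat.card K) (τ : Field.absoluteGaloisGroup K)
    {S : Set W.geomPoints} (hS : S.Finite) {S' : Set W'.geomPoints} (hS' : S'.Finite) :
    ∃ n : ℕ, (∀ P ∈ S, τ • P = σ ^ n • P) ∧ ∀ P ∈ S', τ • P = σ ^ n • P := by
  choose s hs hsP using fun P : W.geomPoints ↦ W.exists_finite_smul_eq_of_eqOn P
  choose s' hs' hsP' using fun P : W'.geomPoints ↦ W'.exists_finite_smul_eq_of_eqOn P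
  obtain ⟨n, hn⟩ := exists_smul_eq_frobenius_pow_smul hσ τ
    (((hS.biUnion fun P _ ↦ hs P) : (⋃ P ∈ S, s P).Finite).union
      ((hS'.biUnion fun P _ ↦ hs' P) : (⋃ P ∈ S', s' P).Finite))
  exact ⟨n, fun P hP ↦ hsP P τ _ fun x hx ↦ hn x (Or.inl (Set.mem_biUnion hP hx)),
    fun P hP ↦ hsP' P τ _ fun x hx ↦ hn x (Or.inr (Set.mem_biUnion hP hx))⟩

end Points

/-! ## Maps of Tate modules commuting with Frobenius are `Γ_k`-equivariant -/

section TateModule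

variable [Finite K] {σ : Field.absoluteGaloisGroup K} {W W' : WeierstrassCurve K} (ℓ : ℕ)
  [Fact ℓ.Prime]

omit [Finite K] in
/-- A `ℤ_ℓ`-linear map commuting with the Frobenius actions commutes with their powers.
[folklore] -/
theorem map_frobenius_pow_smul (f : W.tateModule ℓ →ₗ[ℤ_[ℓ]] W'.tateModule ℓ)
    (hf : ∀ x : W.tateModule ℓ, f (σ • x) = σ • f x) (n : ℕ) (x : W.tateModule ℓ) :
    f (σ ^ n • x) = σ ^ n • f x := by
  induction n generalizing x with
  | zero => rw [pow_zero, one_smul, one_smul]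
  | succ n ih => rw [pow_succ, mul_smul, mul_smul, ih, hf]

/-- **Maps of Tate modules commuting with Frobenius are `Γ_k`-equivariant.** Let `E, E'` be
Weierstrass curves over a finite field `k`, `ℓ` any prime, `σ_q ∈ Γ_k` the Frobenius
(`σ_q x = x ^ q` on `k̄`), and `f : T_ℓ E → T_ℓ E'` a `ℤ_ℓ`-linear map with
`f (σ_q • x) = σ_q • f x` (equivalently `f ∘ T_ℓ(π_E) = T_ℓ(π_{E'}) ∘ f`,
`tateModule_map_frobeniusIsogeny`). Then `f` commutes with the whole of `Γ_k` (module docstring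
for the proof). Hence `Hom_{Γ_k}(T_ℓ E, T_ℓ E')` is the module of `ℤ_ℓ`-linear maps commuting with
Frobenius, the form in which Tate's theorem is applied. Tate, Invent. Math. 2 (1966), p. 138;
Silverman, *AEC*, V.§2. [folklore] -/
theorem smul_comm_of_frobenius (hσ : ∀ x : AlgebraicClosure K, σ • x = x ^ Nat.card K)
    (f : W.tateModule ℓ →ₗ[ℤ_[ℓ]] W'.tateModule ℓ)
    (hf : ∀ x : W.tateModule ℓ, f (σ • x) = σ • f x)
    (τ : Field.absoluteGaloisGroup K) (x : W.tateModule ℓ) : f (τ • x) = τ • f x := by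
  refine TateModule.ext fun n ↦ ?_
  -- `τ = σ ^ j` on the two points `x_n` and `(f x)_n`
  obtain ⟨j, hj, hj'⟩ := exists_smul_eq_frobenius_pow_smul_of_finite₂ W hσ τ
    (Set.finite_singleton (TateModule.proj ℓ n x))
    (Set.finite_singleton (TateModule.proj ℓ n (f x)) : ({TateModule.proj ℓ n (f x)} :
      Set W'.geomPoints).Finite)
  have h1 : TateModule.proj ℓ n (τ • x) = TateModule.proj ℓ n (σ ^ j • x) := by
    rw [TateModule.proj_smul_of_distribMulAction, TateModule.proj_smul_of_distribMulAction]
    exact hj _ rfl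
  rw [TateModule.proj_apply_eq_of_proj_eq f h1, map_frobenius_pow_smul ℓ f hf,
    TateModule.proj_smul_of_distribMulAction, TateModule.proj_smul_of_distribMulAction]
  exact (hj' _ rfl).symm

/-- **`Hom_{Γ_k}(T_ℓ E, T_ℓ E') = {f | f ∘ T_ℓ(π_E) = T_ℓ(π_{E'}) ∘ f}`.** For Weierstrass curves
`E, E'` over a finite field `k`, a prime `ℓ` and the Frobenius `σ_q ∈ Γ_k`, a `ℤ_ℓ`-linear map
`T_ℓ E → T_ℓ E'` is `Γ_k`-equivariant if and only if it intertwines the Tate-module maps of the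
Frobenius isogenies `frobeniusIsogeny hσ`. Tate, Invent. Math. 2 (1966), p. 138 (`F_ℓ = ℚ_ℓ ⊗ ℚ(π)`
is the algebra generated by the image of `G`); Silverman, *AEC*, V.§2. [folklore] -/
theorem forall_smul_comm_iff_comp_tateModule_map_frobeniusIsogeny
    (hσ : ∀ x : AlgebraicClosure K, σ • x = x ^ Nat.card K)
    (f : W.tateModule ℓ →ₗ[ℤ_[ℓ]] W'.tateModule ℓ) :
    (∀ (τ : Field.absoluteGaloisGroup K) (x : W.tateModule ℓ), f (τ • x) = τ • f x) ↔
      f ∘ₗ TateModule.map ℓ (W.frobeniusIsogeny hσ).toAddMonoidHom =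
        TateModule.map ℓ (W'.frobeniusIsogeny hσ).toAddMonoidHom ∘ₗ f := by
  rw [tateModule_map_frobeniusIsogeny, tateModule_map_frobeniusIsogeny]
  refine ⟨fun h ↦ LinearMap.ext fun x ↦ ?_, fun h τ x ↦ smul_comm_of_frobenius ℓ hσ f (fun y ↦ ?_) τ x⟩
  · simp only [LinearMap.coe_comp, Function.comp_apply, galoisRepTate_apply_apply, h]
  · have := LinearMap.congr_fun h y
    simpa only [LinearMap.coe_comp, Function.comp_apply, galoisRepTate_apply_apply] using this

/-- In particular the Tate-module map of any isogeny `E → E'` over `k` intertwines the Frobenius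
isogenies: `T_ℓ(ψ) ∘ T_ℓ(π_E) = T_ℓ(π_{E'}) ∘ T_ℓ(ψ)` (indeed `ψ ∘ π_E = π_{E'} ∘ ψ`).
Silverman, *AEC*, II.2.11 and V.§2. [folklore] -/
theorem tateModule_map_comp_tateModule_map_frobeniusIsogeny
    (hσ : ∀ x : AlgebraicClosure K, σ • x = x ^ Nat.card K) (ψ : Isogeny W W') :
    TateModule.map ℓ ψ.toAddMonoidHom ∘ₗ TateModule.map ℓ (W.frobeniusIsogeny hσ).toAddMonoidHom =
      TateModule.map ℓ (W'.frobeniusIsogeny hσ).toAddMonoidHom ∘ₗ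
        TateModule.map ℓ ψ.toAddMonoidHom :=
  (forall_smul_comm_iff_comp_tateModule_map_frobeniusIsogeny ℓ hσ _).mp fun τ _ ↦
    TateModule.ext fun _ ↦ ψ.equivariant τ _

end TateModule

end WeierstrassCurve
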